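import Mathlib.Data.Real.Basic
import Mathlib.Tactic
import Literature.Probability.LatticeModels.LatticeGraph
import Summits.QuantumFields.YangMills.Theorems.BalabanUVNodesN07PointFeasibilityEnergyIdentity
import HarnessLib

/-!
# DAG node N07 — (P)_D IN DIMENSION ONE: the per-tile criterion (C_{ℓ,1}) for every odd ℓ, and the
# point-feasibility lemma for EVERY tiling of the cycle `ℤ∕N` by odd intervals (nesting-agnostic)

Width seat `pub-ymgap-dag-n07-w7` (g3), count-neutral helper.  Companion of
`…Theorems.BalabanUVNodesN07PointFeasibilityEnergyIdentity` (the energy identity and «local criterion ⇒ (P)_D» on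
`TorusSite d N`, any tiling): here the criterion is PROVED for `d = 1` and interval tiles of any odd length
`ℓ = 2r+1` with the true centre (LOCATED-PD-TILE-CRITERION §4, dag-n07-w7 g2: `m₁(ℓ,1) = (5∕144)r²(r+1)²(2r+1)`),
so (P)_D holds on `TorusSite 1 N` for every tiling by odd intervals of ANY sizes — the first nesting-agnostic case.
(In `d ≥ 3` the per-tile criterion FAILS and (P)_D is OPEN; this file says nothing about `d ≥ 2`.)

* §1 `symSum r F = F 0 + Σ_{w<r} (F (w+1) + F (−(w+1)))` (the sum over `|v| ≤ r`), power sums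
  `6·Σ_{w≤r} w² = r(r+1)(2r+1)`, `30·Σ w⁴ = r(r+1)(2r+1)(3r²+3r−1)`.
* §2 `quad_of_secondDiff_const`: `ν(v+1) + ν(v−1) − 2ν(v) = β` for `|v| ≤ r` ⇒ `ν` is the quadratic
  `α + a v + (β∕2)v²` on `|v| ≤ r+1`.
* §3 on `TorusSite 1 N`, along `e = Pi.single 0 1`: `lap` in `d = 1`, the second-difference recursion of
  `E(w) = μ(c+we) + μ(c−we) − 2μ(c)` and its closed form `E(w) = αw² + βw²(w²−1)∕12`.
* §4 ★★★ `tileCriterion_d1`: if `Δ²μ = β` on the `2r+1` points `c + v e`, `|v| ≤ r`, then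
  `Φ = Σ_{|v|≤r} (Δμ(c+ve))² − β·Σ_{|v|≤r} (μ(c+ve) − μ(c)) ≥ 0`, with equality only if `Δμ = 0` at those points;
  the proof is the explicit sum of squares `Φ = Λ(α + Sβ∕2Λ)² + (5∕24)·S·r(r+1)·β² + 2S·a²`
  (`Λ = 2r+1`, `S = Σ_{w≤r} w²`).
* §5 ★★★ `pointFeasibility_d1`: for EVERY tiling of `TorusSite 1 N` by odd intervals (any sizes, any nesting), a `μ`
  with one value on all centres and tile-wise constant `Δ²μ` is constant — `pointFeasibility_of_localCriterion` of
  the companion file with clusters = tiles and `e = (Δμ)²`.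

HONEST SCOPE.  Elementary algebra on one cycle; asserts NOTHING about [B11]∕[B6]∕[3]; `d = 1` only; `hker` at the
record, stub 1, K0⁷ ∕ K1⁸ NOT closed; N07 not discharged; nothing continuum ∕ OS ∕ mass gap.  Context (no
hypothesis is a citation): T. Bałaban, CMP **109** (1987) 249–301 [Balaban1987RG1] (0.4).
-/

set_option autoImplicit false

noncomputable section

open Finset

namespace Summit.QuantumFields.YangMills.Theorems.N07PointFeasibilityD1

open Literature.Probability.LatticeModels (TorusSite)
open Summit.QuantumFields.YangMills.Theorems.N07PointFeasibilityEnergyIdentity (lap)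

/-! ## §1  Symmetric sums and two power sums -/

/-- The sum of `F` over the integers `|v| ≤ r`, written as `F 0 + Σ_{w<r} (F (w+1) + F (−(w+1)))`. [folklore] -/
def symSum (r : ℕ) (F : ℤ → ℝ) : ℝ :=
  F 0 + ∑ w ∈ Finset.range r, (F ((w : ℤ) + 1) + F (-((w : ℤ) + 1)))

/-- `symSum` is additive. [folklore] -/
theorem symSum_add (r : ℕ) (F G : ℤ → ℝ) : symSum r (fun v => F v + G v) = symSum r F + symSum r G := by
  simp only [symSum, Finset.sum_add_distrib]; ring

/-- `symSum` is homogeneous. [folklore] -/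
theorem symSum_mul (r : ℕ) (κ : ℝ) (F : ℤ → ℝ) : symSum r (fun v => κ * F v) = κ * symSum r F := by
  simp only [symSum, ← Finset.mul_sum, Finset.sum_add_distrib]; ring

/-- `symSum` of a function vanishing on `|v| ≤ r` is zero. [folklore] -/
theorem symSum_eq_zero {r : ℕ} {F : ℤ → ℝ} (h : ∀ v : ℤ, |v| ≤ r → F v = 0) : symSum r F = 0 := by
  unfold symSum
  rw [h 0 (by simp), zero_add]
  refine Finset.sum_eq_zero (fun w hw => ?_)
  have hw' : w < r := Finset.mem_range.1 hw
  rw [h ((w : ℤ) + 1) (by rw [abs_of_nonneg (by positivity)]; exact_mod_cast hw'),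
    h (-((w : ℤ) + 1)) (by rw [abs_neg, abs_of_nonneg (by positivity)]; exact_mod_cast hw'), add_zero]

/-- `6·Σ_{w<r} (w+1)² = r(r+1)(2r+1)`. [folklore] -/
theorem six_mul_sum_sq (r : ℕ) :
    6 * ∑ w ∈ Finset.range r, ((w : ℝ) + 1) ^ 2 = (r : ℝ) * (r + 1) * (2 * r + 1) := by
  induction r with
  | zero => simp
  | succ r ih => rw [Finset.sum_range_succ, mul_add, ih]; push_cast; ring

/-- `30·Σ_{w<r} (w+1)⁴ = r(r+1)(2r+1)(3r²+3r−1)`. [folklore] -/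
theorem thirty_mul_sum_pow_four (r : ℕ) :
    30 * ∑ w ∈ Finset.range r, ((w : ℝ) + 1) ^ 4 =
      (r : ℝ) * (r + 1) * (2 * r + 1) * (3 * r ^ 2 + 3 * r - 1) := by
  induction r with
  | zero => simp
  | succ r ih => rw [Finset.sum_range_succ, mul_add, ih]; push_cast; ring

/-! ## §2  Constant second difference ⇒ quadratic -/

/-- **Discrete Taylor**: if `ν(v+1) + ν(v−1) − 2ν(v) = β` for all `|v| ≤ r`, then for `0 ≤ k ≤ r+1`,
`ν(±k) = α ± a k + (β∕2)k²` with `α = ν 0`, `a = (ν 1 − ν(−1))∕2`. [folklore] -/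
theorem quad_of_secondDiff_const (ν : ℤ → ℝ) (β : ℝ) (r : ℕ)
    (h : ∀ v : ℤ, |v| ≤ r → ν (v + 1) + ν (v - 1) - 2 * ν v = β) :
    ∀ k : ℕ, k ≤ r + 1 →
      ν k = ν 0 + (ν 1 - ν (-1)) / 2 * k + β / 2 * (k : ℝ) ^ 2 ∧
      ν (-(k : ℤ)) = ν 0 - (ν 1 - ν (-1)) / 2 * k + β / 2 * (k : ℝ) ^ 2 := by
  intro k
  induction k using Nat.twoStepInduction with
  | zero => intro _; simp
  | one =>
      intro _
      have h0 := h 0 (by simp)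
      simp only [zero_add, zero_sub, mul_comm] at h0
      refine ⟨?_, ?_⟩ <;> · push_cast; linarith
  | more k ih0 ih1 =>
      intro hk
      have hk1 : ((k : ℤ) + 1).natAbs ≤ r := by omega
      have hp := h ((k : ℤ) + 1) (by rw [abs_of_nonneg (by positivity)]; exact_mod_cast (by omega : k + 1 ≤ r))
      have hm := h (-((k : ℤ) + 1)) (by
        rw [abs_neg, abs_of_nonneg (by positivity)]; exact_mod_cast (by omega : k + 1 ≤ r))
      obtain ⟨e0p, e0m⟩ := ih0 (by omega)
      obtain ⟨e1p, e1m⟩ := ih1 (by omega)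
      have c1 : ((k + 1 : ℕ) : ℤ) = (k : ℤ) + 1 := by push_cast; ring
      have c2 : ((k + 2 : ℕ) : ℤ) = (k : ℤ) + 1 + 1 := by push_cast; ring
      rw [c1] at e1p e1m
      refine ⟨?_, ?_⟩
      · rw [c2]
        have : ν ((k : ℤ) + 1 + 1) = β + 2 * ν ((k : ℤ) + 1) - ν k := by
          have := hp; rw [add_sub_cancel_right] at this; linarith
        rw [this, e1p, e0p]; push_cast; ring
      · rw [c2, show -((k : ℤ) + 1 + 1) = -((k : ℤ) + 1) - 1 by ring]
        have : ν (-((k : ℤ) + 1) - 1) = β + 2 * ν (-((k : ℤ) + 1)) - ν (-(k : ℤ)) := by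
          have := hm; rw [show -((k : ℤ) + 1) + 1 = -(k : ℤ) by ring] at this; linarith
        rw [this, e1m, e0m]; push_cast; ring

/-! ## §3  The cycle `TorusSite 1 N`: points `c + v·e`, the Laplacian in `d = 1`, the even combination
`E(w) = μ(c+we) + μ(c−we) − 2μ(c)` -/

section Cycle

variable {N : ℕ}

/-- The point `c + v·e` of the cycle, `e = Pi.single 0 1`, `v ∈ ℤ`. [folklore] -/
def pt (c : TorusSite 1 N) (v : ℤ) : TorusSite 1 N := c + v • (Pi.single 0 1 : TorusSite 1 N)

/-- `c + 0·e = c`. [folklore] -/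
@[simp] theorem pt_zero (c : TorusSite 1 N) : pt c 0 = c := by simp [pt]

/-- `(c + v·e) + e = c + (v+1)·e`. [folklore] -/
theorem pt_add_e (c : TorusSite 1 N) (v : ℤ) : pt c v + Pi.single 0 1 = pt c (v + 1) := by
  simp only [pt, add_zsmul, one_zsmul, add_assoc]

/-- `(c + v·e) − e = c + (v−1)·e`. [folklore] -/
theorem pt_sub_e (c : TorusSite 1 N) (v : ℤ) : pt c v - Pi.single 0 1 = pt c (v - 1) := by
  unfold pt
  rw [sub_zsmul, one_zsmul]
  abel

/-- The Laplacian in `d = 1`: `Δf x = f (x + e) + f (x − e) − 2 f x`. [folklore] -/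
theorem lap_one (f : TorusSite 1 N → ℝ) (x : TorusSite 1 N) :
    lap f x = f (x + Pi.single 0 1) + f (x - Pi.single 0 1) - 2 * f x := by
  simp only [lap, Fin.sum_univ_one]

/-- `Δf (c + v·e) = f(c+(v+1)e) + f(c+(v−1)e) − 2 f(c+ve)`. [folklore] -/
theorem lap_pt (f : TorusSite 1 N → ℝ) (c : TorusSite 1 N) (v : ℤ) :
    lap f (pt c v) = f (pt c (v + 1)) + f (pt c (v - 1)) - 2 * f (pt c v) := by
  rw [lap_one, pt_add_e, pt_sub_e]

/-- ★ **Closed form of the even combination.**  If `Δ²μ = β` at the points `c + v·e`, `|v| ≤ r`, then with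
`α = Δμ(c)`, for `0 ≤ k ≤ r+1`: `μ(c+ke) + μ(c−ke) − 2μ(c) = α k² + β k²(k²−1)∕12` (two-step induction on the
recursion `E(k+1) − 2E(k) + E(k−1) = Δμ(c+ke) + Δμ(c−ke) = 2α + βk²`). [folklore] -/
theorem even_combination_eq (μ : TorusSite 1 N → ℝ) (c : TorusSite 1 N) (β : ℝ) (r : ℕ)
    (h : ∀ v : ℤ, |v| ≤ r → lap (lap μ) (pt c v) = β) :
    ∀ k : ℕ, k ≤ r + 1 →
      μ (pt c k) + μ (pt c (-(k : ℤ))) - 2 * μ c =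
        lap μ c * (k : ℝ) ^ 2 + β * ((k : ℝ) ^ 2 * ((k : ℝ) ^ 2 - 1) / 12) := by
  have hq := quad_of_secondDiff_const (fun v => lap μ (pt c v)) β r
    (fun v hv => by rw [← lap_pt]; exact h v hv)
  simp only [pt_zero] at hq
  intro k
  induction k using Nat.twoStepInduction with
  | zero => intro _; push_cast; simp only [neg_zero, pt_zero]; ring
  | one =>
      intro _
      have e := lap_pt μ c 0
      simp only [zero_add, zero_sub, pt_zero] at e
      push_cast
      linear_combination (-1 : ℝ) * e
  | more k ih0 ih1 =>
      intro hk
      obtain ⟨qp, qm⟩ := hq (k + 1) (by omega)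
      have e1 := lap_pt μ c ((k : ℤ) + 1)
      have e2 := lap_pt μ c (-((k : ℤ) + 1))
      have c1 : ((k + 1 : ℕ) : ℤ) = (k : ℤ) + 1 := by push_cast; ring
      have c2 : ((k + 2 : ℕ) : ℤ) = (k : ℤ) + 1 + 1 := by push_cast; ring
      rw [c1] at qp qm ih1
      have i0 := ih0 (by omega)
      have i1 := ih1 (by omega)
      rw [add_sub_cancel_right] at e1
      rw [show -((k : ℤ) + 1) + 1 = -(k : ℤ) by ring, show -((k : ℤ) + 1) - 1 = -((k : ℤ) + 1 + 1) by ring]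
        at e2
      rw [c2]
      push_cast at i0 i1 qp qm ⊢
      linear_combination (-1 : ℝ) * e1 + (-1 : ℝ) * e2 + qp + qm + (-1 : ℝ) * i0 + 2 * i1

end Cycle

/-! ## §4  ★★★ The per-tile criterion (C_{ℓ,1}) for every odd `ℓ = 2r+1` -/

section Tile

variable {N : ℕ}

/-- ★★★ **The per-tile criterion in `d = 1`** (LOCATED-PD-TILE-CRITERION §4, `m₁(ℓ,1) = (5∕144)r²(r+1)²(2r+1)`):
for `μ` on the cycle, a centre `c` and a radius `r`, if `Δ²μ = β` at the `2r+1` points `c + v·e` (`|v| ≤ r`), then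
`Φ = Σ_{|v|≤r} (Δμ(c+ve))² − β·Σ_{|v|≤r} (μ(c+ve) − μ(c)) ≥ 0`, with EQUALITY only if `Δμ(c+ve) = 0` for all
`|v| ≤ r`.  Proof: `Δμ(c+ve) = α + a v + (β∕2)v²` on `|v| ≤ r+1` (§2), the even combination (§3), the power sums
(§1), and the sum of squares `Φ = (2r+1)(α + Sβ∕(2(2r+1)))² + (5∕24)·S·r(r+1)·β² + 2S·a²`, `S = Σ_{w≤r} w²`.
[folklore] -/
theorem tileCriterion_d1 (μ : TorusSite 1 N → ℝ) (c : TorusSite 1 N) (r : ℕ) (β : ℝ)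
    (h : ∀ v : ℤ, |v| ≤ r → lap (lap μ) (pt c v) = β) :
    0 ≤ symSum r (fun v => lap μ (pt c v) ^ 2) - β * symSum r (fun v => μ (pt c v) - μ c) ∧
    (symSum r (fun v => lap μ (pt c v) ^ 2) - β * symSum r (fun v => μ (pt c v) - μ c) = 0 →
      ∀ v : ℤ, |v| ≤ r → lap μ (pt c v) = 0) := by
  have hq := quad_of_secondDiff_const (fun v => lap μ (pt c v)) β r
    (fun v hv => by rw [← lap_pt]; exact h v hv)
  simp only [pt_zero] at hq
  have hE := even_combination_eq μ c β r h
  -- letters (introduced after `hq`, `hE`, so that `set` abbreviates inside them)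
  set α : ℝ := lap μ c with hα
  set a : ℝ := (lap μ (pt c 1) - lap μ (pt c (-1))) / 2 with ha
  set S : ℝ := ∑ w ∈ Finset.range r, ((w : ℝ) + 1) ^ 2 with hS
  set S4 : ℝ := ∑ w ∈ Finset.range r, ((w : ℝ) + 1) ^ 4 with hS4
  -- E1 : the sum of squares of `ν`
  have hE1 : symSum r (fun v => lap μ (pt c v) ^ 2) =
      (2 * r + 1) * α ^ 2 + 2 * S * a ^ 2 + 2 * S * α * β + S4 / 2 * β ^ 2 := by
    unfold symSum
    have hsum : ∑ w ∈ Finset.range r,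
        (lap μ (pt c ((w : ℤ) + 1)) ^ 2 + lap μ (pt c (-((w : ℤ) + 1))) ^ 2) =
        ∑ w ∈ Finset.range r, (2 * α ^ 2 + 2 * a ^ 2 * ((w : ℝ) + 1) ^ 2 +
          2 * α * β * ((w : ℝ) + 1) ^ 2 + β ^ 2 / 2 * ((w : ℝ) + 1) ^ 4) := by
      refine Finset.sum_congr rfl (fun w hw => ?_)
      have hw : w < r := Finset.mem_range.1 hw
      obtain ⟨qp, qm⟩ := hq (w + 1) (by omega)
      have c1 : ((w + 1 : ℕ) : ℤ) = (w : ℤ) + 1 := by push_cast; ring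
      rw [c1] at qp qm
      rw [qp, qm]; push_cast; ring
    simp only [hsum, pt_zero, Finset.sum_add_distrib, ← Finset.mul_sum, Finset.sum_const, Finset.card_range,
      nsmul_eq_mul]
    ring
  -- E2 : the centre defect
  have hE2 : symSum r (fun v => μ (pt c v) - μ c) = α * S + β / 12 * (S4 - S) := by
    unfold symSum
    have hsum : ∑ w ∈ Finset.range r,
        (μ (pt c ((w : ℤ) + 1)) - μ c + (μ (pt c (-((w : ℤ) + 1))) - μ c)) =
        ∑ w ∈ Finset.range r, (α * ((w : ℝ) + 1) ^ 2 +
          (β / 12 * ((w : ℝ) + 1) ^ 4 - β / 12 * ((w : ℝ) + 1) ^ 2)) := by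
      refine Finset.sum_congr rfl (fun w hw => ?_)
      have hw : w < r := Finset.mem_range.1 hw
      have e := hE (w + 1) (by omega)
      have c1 : ((w + 1 : ℕ) : ℤ) = (w : ℤ) + 1 := by push_cast; ring
      rw [c1] at e
      push_cast at e
      linear_combination e
    simp only [hsum, pt_zero, sub_self, zero_add, Finset.sum_add_distrib, Finset.sum_sub_distrib,
      ← Finset.mul_sum]
    ring
  -- the sum of squares
  have hS' : S = (r : ℝ) * (r + 1) * (2 * r + 1) / 6 := by
    have := six_mul_sum_sq r; rw [← hS] at this; linarith
  have hS4' : S4 = (r : ℝ) * (r + 1) * (2 * r + 1) * (3 * r ^ 2 + 3 * r - 1) / 30 := by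
    have := thirty_mul_sum_pow_four r; rw [← hS4] at this; linarith
  have hΛ : (0 : ℝ) < 2 * r + 1 := by positivity
  have hsos : symSum r (fun v => lap μ (pt c v) ^ 2) - β * symSum r (fun v => μ (pt c v) - μ c) =
      (2 * r + 1) * (α + S * β / (2 * (2 * r + 1))) ^ 2 + 5 / 24 * S * (r * (r + 1)) * β ^ 2 +
        2 * S * a ^ 2 := by
    rw [hE1, hE2, hS', hS4']
    field_simp
    ring
  have hSnn : 0 ≤ S := Finset.sum_nonneg (fun w _ => by positivity)
  refine ⟨by rw [hsos]; positivity, fun h0 => ?_⟩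
  rw [hsos] at h0
  have t1 : 0 ≤ (2 * r + 1) * (α + S * β / (2 * (2 * r + 1))) ^ 2 := by positivity
  have t2 : 0 ≤ 5 / 24 * S * (r * (r + 1)) * β ^ 2 := by positivity
  have t3 : 0 ≤ 2 * S * a ^ 2 := by positivity
  have z1 : (2 * r + 1) * (α + S * β / (2 * (2 * r + 1))) ^ 2 = 0 := by linarith
  have z2 : 5 / 24 * S * (r * (r + 1)) * β ^ 2 = 0 := by linarith
  have z3 : 2 * S * a ^ 2 = 0 := by linarith
  have z1' : α + S * β / (2 * (2 * r + 1)) = 0 := by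
    have := mul_eq_zero.1 z1
    rcases this with h' | h'
    · exact absurd h' (ne_of_gt hΛ)
    · exact pow_eq_zero_iff (n := 2) (by norm_num) |>.1 h'
  -- the case `r = 0`: only `v = 0`, and `α = 0`
  rcases Nat.eq_zero_or_pos r with hr | hr
  · subst hr
    intro v hv
    have hv0 : v = 0 := by simpa using hv
    subst hv0
    have hS0 : S = 0 := by rw [hS]; simp
    rw [hS0] at z1'
    simpa [hα] using z1'
  -- the case `r ≥ 1`: `S > 0`, so `β = a = α = 0` and `ν ≡ 0` on `|v| ≤ r+1`
  have hSpos : 0 < S := by rw [hS']; positivity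
  have hr' : (0 : ℝ) < r := by exact_mod_cast hr
  have hrr : (0 : ℝ) < r * (r + 1) := by positivity
  have hβ0 : β = 0 := by
    have := mul_eq_zero.1 z2
    rcases this with h' | h'
    · rcases mul_eq_zero.1 h' with h'' | h''
      · rcases mul_eq_zero.1 h'' with h3 | h3
        · norm_num at h3
        · exact absurd h3 (ne_of_gt hSpos)
      · exact absurd h'' (ne_of_gt hrr)
    · exact pow_eq_zero_iff (n := 2) (by norm_num) |>.1 h'
  have ha0 : a = 0 := by
    have := mul_eq_zero.1 z3
    rcases this with h' | h'
    · rcases mul_eq_zero.1 h' with h'' | h''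
      · norm_num at h''
      · exact absurd h'' (ne_of_gt hSpos)
    · exact pow_eq_zero_iff (n := 2) (by norm_num) |>.1 h'
  have hα0 : α = 0 := by rw [hβ0] at z1'; simpa using z1'
  intro v hv
  have hk : v.natAbs ≤ r := by
    have : (v.natAbs : ℤ) ≤ r := by rw [← Int.abs_eq_natAbs]; exact hv
    exact_mod_cast this
  obtain ⟨qp, qm⟩ := hq v.natAbs (by omega)
  rw [hα0, hβ0, ha0] at qp qm
  simp only [zero_mul, zero_div, add_zero, sub_zero] at qp qm
  rcases Int.natAbs_eq v with hv' | hv'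
  · rw [hv']; exact qp
  · rw [hv']; exact qm

end Tile

/-! ## §5  ★★★ (P)_D on the cycle for EVERY tiling by odd intervals -/

section Global

/-- `Σ_{v ∈ [−r, r]} F v = symSum r F`. [folklore] -/
theorem sum_Icc_eq_symSum (r : ℕ) (F : ℤ → ℝ) :
    ∑ v ∈ Finset.Icc (-(r : ℤ)) r, F v = symSum r F := by
  induction r with
  | zero => simp [symSum]
  | succ r ih =>
      have hI : Finset.Icc (-((r + 1 : ℕ) : ℤ)) ((r + 1 : ℕ) : ℤ) =
          insert ((r : ℤ) + 1) (insert (-((r : ℤ) + 1)) (Finset.Icc (-(r : ℤ)) r)) := by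
        ext v; simp only [Finset.mem_Icc, Finset.mem_insert]; push_cast; omega
      rw [hI, Finset.sum_insert (by simp only [Finset.mem_insert, Finset.mem_Icc]; omega),
        Finset.sum_insert (by simp only [Finset.mem_Icc]; omega), ih]
      unfold symSum
      rw [Finset.sum_range_succ]
      ring

variable {N : ℕ} [NeZero N] {τ : Type*} [Fintype τ] [DecidableEq τ]

/-- ★★★ **(P)_D in dimension one, nesting-agnostic.**  Let the cycle `TorusSite 1 N` be tiled by intervals:
`tile x = t ↔ x = ctr t + v·e` for some `|v| ≤ rad t` (odd lengths `2·rad t + 1`, true centres `ctr t`, ANY sizes),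
the `2·rad t + 1` points of each tile being distinct.  If `μ` takes one value `h` at every centre and `Δ²μ` is
constant on every tile, then `μ ≡ h`.  Proof: `pointFeasibility_of_localCriterion` of the companion file with
clusters = tiles and the pure energy split `e = (Δμ)²`, each tile's criterion being `tileCriterion_d1`. [folklore] -/
theorem pointFeasibility_d1 (tile : TorusSite 1 N → τ) (ctr : τ → TorusSite 1 N) (rad : τ → ℕ)
    (htile : ∀ x t, tile x = t ↔ ∃ v : ℤ, |v| ≤ rad t ∧ x = pt (ctr t) v)
    (hinj : ∀ t (v w : ℤ), |v| ≤ rad t → |w| ≤ rad t → pt (ctr t) v = pt (ctr t) w → v = w)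
    {μ : TorusSite 1 N → ℝ} {β : τ → ℝ} {h : ℝ} (hc : ∀ t, μ (ctr t) = h)
    (hβ : ∀ x, lap (lap μ) x = β (tile x)) (x : TorusSite 1 N) : μ x = h := by
  classical
  refine N07PointFeasibilityEnergyIdentity.pointFeasibility_of_localCriterion tile ctr tile hc hβ
    (fun x => lap μ x ^ 2) rfl (fun s => ?_) x
  -- the tile `s` as the image of `[−rad s, rad s]` under `v ↦ ctr s + v·e`
  have hmem : ∀ v : ℤ, |v| ≤ rad s → tile (pt (ctr s) v) = s := fun v hv => (htile _ s).2 ⟨v, hv, rfl⟩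
  have hset : Finset.univ.filter (fun x => tile x = s) =
      (Finset.Icc (-(rad s : ℤ)) (rad s)).image (pt (ctr s)) := by
    ext x
    simp only [Finset.mem_filter, Finset.mem_univ, true_and, Finset.mem_image, Finset.mem_Icc, ← abs_le]
    constructor
    · intro hx; obtain ⟨v, hv, rfl⟩ := (htile x s).1 hx; exact ⟨v, hv, rfl⟩
    · rintro ⟨v, hv, rfl⟩; exact hmem v hv
  have hsum : ∀ G : TorusSite 1 N → ℝ, ∑ x ∈ Finset.univ.filter (fun x => tile x = s), G x =
      symSum (rad s) (fun v => G (pt (ctr s) v)) := by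
    intro G
    rw [hset, Finset.sum_image (fun v hv w hw hvw => hinj s v w
      (abs_le.2 (Finset.mem_Icc.1 hv)) (abs_le.2 (Finset.mem_Icc.1 hw)) hvw), sum_Icc_eq_symSum]
  have hβs : ∀ v : ℤ, |v| ≤ rad s → lap (lap μ) (pt (ctr s) v) = β s := fun v hv => by rw [hβ, hmem v hv]
  have hcrit := tileCriterion_d1 μ (ctr s) (rad s) (β s) hβs
  -- the cluster functional of the tile `s` IS the per-tile functional `Φ`
  have hΦ : ∑ x ∈ Finset.univ.filter (fun x => tile x = s),
      (lap μ x ^ 2 - β (tile x) * (μ x - μ (ctr (tile x)))) =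
      symSum (rad s) (fun v => lap μ (pt (ctr s) v) ^ 2) -
        β s * symSum (rad s) (fun v => μ (pt (ctr s) v) - μ (ctr s)) := by
    rw [hsum, ← symSum_mul, sub_eq_add_neg, ← neg_one_mul, ← symSum_mul, ← symSum_add]
    unfold symSum
    simp only [pt_zero]
    refine congrArg₂ (· + ·) (by rw [(htile (ctr s) s).2 ⟨0, by simp, (pt_zero _).symm⟩]; ring)
      (Finset.sum_congr rfl (fun w hw => ?_))
    have hw : w < rad s := Finset.mem_range.1 hw
    rw [hmem _ (by rw [abs_of_nonneg (by positivity)]; exact_mod_cast hw),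
      hmem _ (by rw [abs_neg, abs_of_nonneg (by positivity)]; exact_mod_cast hw)]
    ring
  rw [hΦ]
  refine ⟨hcrit.1, fun h0 y hy => ?_⟩
  obtain ⟨v, hv, rfl⟩ := (htile y s).1 hy
  exact hcrit.2 h0 v hv

end Global

end Summit.QuantumFields.YangMills.Theorems.N07PointFeasibilityD1

end
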